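import Summits.BirchSwinnertonDyer.BirchSwinnertonDyer.Theorems.ErratumRoadFiveAuxPrimeFrobeniusWitness
import Literature.NumberTheory.EllipticCurves.SerreOpenImageDeterminantProofs
import Mathlib.NumberTheory.Basic
import HarnessLib

/-!
# Route `ErratumRoadFive` (rung K2), crux `NonSurjCorner` (item stmt-BirchSwinnertonDyer-19065), line `Lines/hybrid.lean`, r22 slot 6″, step (L1):
# the FROBENIUS PRE-WITNESS at an image of order prime to `p`, from K-DISJOINTNESS and a trace property of the image
# (cell `bsd-stepL`, seat `bsd-stepL-corner-p1` g18; `--supports stmt-BirchSwinnertonDyer-19065 --as helper`)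

WHY THIS FILE. After `…NonSurjCornerAuxPrimeSupplyOfPreWitness` (this seat) the corner's Chebotarev–Kummer auxiliary-prime supply — hence the
(B6)-free Euler half of 19065 (road B) — hinges on ONE Galois statement per corner pair and level `p^E`, the PRE-WITNESS
`∃ γ ∈ Γ_ℚ ∖ res Γ_K, γ ζ_{p^E} = ζ_{p^E}⁻¹, tr ρ̄_{E,p}(γ) ≢ 0`. -w2 g5 built it (surjective image) as `c₀ · [shears]`. At the corner images
(order prime to `p`, no unipotents) this file builds it as `γ = c₀ · τ^{p^{E-1}}` from two inputs that are statements about the IMAGE GROUP only: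
(K) K-DISJOINTNESS — every value of `ρ̄_{E,p}` on `Γ_ℚ` is taken on `res Γ_K` (i.e. `K ⊄ ℚ(E[p])`; on the line's inert frames this is «`p` inert
in `K` but split ∕ ramified in the quadratic subfields of `ℚ(E[p])`», memo CORNER-G18 §5′); (T) for every `g ∈ Γ_ℚ` some `σ₀` with
`det ρ̄(σ₀) = 1` has `tr ρ̄(g σ₀) ≠ 0` (the determinant-one part of the image is trace-orthogonal to no element of the image — true for the two
corner images `N(C_s)` and Zywina's `G₉`, lane B's exact-image theorems; a finite check). Construction: `c₀` complex conjugation (`c₀ ∉ res Γ_K`,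
`c₀ ζ = ζ⁻¹`); `σ₀` from (T) for `g = c₀`, `x₀ = ρ̄(σ₀)` of order `n` prime to `p`; `s` with `s·p^{E-1} ≡ 1 (mod n)`; `τ ∈ res Γ_K` with
`ρ̄(τ) = x₀^s` from (K); `k = τ^{p^{E-1}}` has `ρ̄(k) = x₀` and FIXES `ζ` (`det ρ̄(τ) = 1` ⇒ `τ` fixes `ζ_p` ⇒ `τ ζ = ζ^a` with `a ≡ 1 (p)` ⇒
`a^{p^{E-1}} ≡ 1 (p^E)`); `γ = c₀ k`.
* `AuxPrimeSupplyCorner.exists_preWitness_of_rangeK`.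

HONEST FRAMING: ONE THEOREM (no definition, no named fact, no `sorry`); pure Galois∕group theory; CONDITIONAL on (K) and (T); nothing about any
curve's BSD; 19065 NOT closed; BSD is not advanced; T7.
References (locators only): [cite: GrossLMS1991, §3 (p. 239), §9] [cite: Serre1972, §2.2, §2.6] [cite: Cox2013, Thm. 8.12].
-/

noncomputable section

set_option autoImplicit false
set_option linter.dupNamespace false -- `Summit.BirchSwinnertonDyer.BirchSwinnertonDyer` (summit = problem), tree-wide

open scoped Classical NumberField
open WeierstrassCurve NumberField Field
open Literature.NumberTheory.GaloisRepresentations Literature.NumberTheory.EllipticCurves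

namespace Summit.BirchSwinnertonDyer.BirchSwinnertonDyer.Theorems.AuxPrimeSupplyCorner

open Summit.BirchSwinnertonDyer.BirchSwinnertonDyer.Theorems.AuxPrimeSupply

/-- **The Frobenius pre-witness from K-disjointness (K) and the trace property (T) of an image of order prime to `p`.** See the module docstring
for the construction `γ = c₀ · τ^{p^{E-1}}`. [cite: GrossLMS1991, §9] [cite: Serre1972, §2.2] -/
theorem exists_preWitness_of_rangeK (W : WeierstrassCurve ℚ) [W.IsElliptic] {K : Type} [Field K]
    [NumberField K] (hK : IsImaginaryQuadratic K) {p : ℕ} [Fact p.Prime]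
    (Φ : Multiplicative (AddAut (geomTorsion W p)) ≃* GL (Fin 2) (ZMod p))
    (htr : letI : Module (ZMod p) (geomTorsion W p) := AddSubgroup.torsionBy.zmodModule
      ∀ g : Multiplicative (AddAut (geomTorsion W p)),
        Matrix.trace ((Φ g : GL (Fin 2) (ZMod p)) : Matrix (Fin 2) (Fin 2) (ZMod p)) =
          LinearMap.trace (ZMod p) (geomTorsion W p) ((Multiplicative.toAdd g).toAddMonoidHom.toZModLinearMap p))
    (hdet : ∀ σ : absoluteGaloisGroup ℚ,
      Matrix.GeneralLinearGroup.det (Φ (galoisRepTorsion W p σ)) = modPCyclotomicCharacterZMod ℚ p σ)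
    (hcop : ¬ p ∣ Nat.card (galoisRepTorsion W p).range)
    -- (K) K-disjointness: every value of `ρ̄` is taken on `res Γ_K`
    (hKE : ∀ σ : absoluteGaloisGroup ℚ, ∃ τ : absoluteGaloisGroup ℚ,
      τ ∈ (absGaloisRestrict ℚ K).range ∧ galoisRepTorsion W p τ = galoisRepTorsion W p σ)
    -- (T) the determinant-one part of the image is trace-orthogonal to no element of the image
    (hT : ∀ g : absoluteGaloisGroup ℚ, ∃ σ₀ : absoluteGaloisGroup ℚ,
      Matrix.GeneralLinearGroup.det (Φ (galoisRepTorsion W p σ₀)) = 1 ∧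
      Matrix.trace ((Φ (galoisRepTorsion W p (g * σ₀)) : GL (Fin 2) (ZMod p)) : Matrix (Fin 2) (Fin 2) (ZMod p)) ≠ 0)
    {E : ℕ} (hE : 1 ≤ E) {ζ : AlgebraicClosure ℚ} (hζ : IsPrimitiveRoot ζ (p ^ E)) :
    ∃ γ : absoluteGaloisGroup ℚ, γ ∉ (absGaloisRestrict ℚ K).range ∧ γ • ζ = ζ⁻¹ ∧
      letI : Module (ZMod p) (geomTorsion W p) := AddSubgroup.torsionBy.zmodModule
      LinearMap.trace (ZMod p) (geomTorsion W p)
        ((galoisRepTorsion W p γ).toAdd.toAddMonoidHom.toZModLinearMap p) ≠ 0 := by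
  letI : Module (ZMod p) (geomTorsion W p) := AddSubgroup.torsionBy.zmodModule
  have hp : p.Prime := Fact.out
  haveI : NeZero (p ^ E) := ⟨pow_ne_zero E hp.ne_zero⟩
  set H := (absGaloisRestrict ℚ K).range with hH
  set ρ := galoisRepTorsion W p with hρ
  -- complex conjugation
  obtain ⟨c₀, hc₀⟩ := exists_isComplexConjugation (Rat.castHom ℝ)
  have hc₀H : c₀ ∉ H := Rat.not_mem_range_absGaloisRestrict_of_isComplexConjugation K hK.2 hc₀
  have hc₀ζ : c₀ • ζ = ζ⁻¹ :=
    smul_eq_inv_of_cyclotomicCharacter_eq_neg_one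
      (modNCyclotomicCharacter_of_isComplexConjugation (K := ℚ) (N := p ^ E) hc₀) hζ.pow_eq_one
  -- (T): `σ₀` with `det ρ̄(σ₀) = 1`, `tr ρ̄(c₀ σ₀) ≠ 0`; `x₀ = ρ̄(σ₀)` has order `n` prime to `p`
  obtain ⟨σ₀, hdet1, htr0⟩ := hT c₀
  set x₀ := ρ σ₀ with hx₀
  set n := orderOf x₀ with hn
  have hndvd : n ∣ Nat.card ρ.range := Subgroup.orderOf_dvd_natCard ρ.range ⟨σ₀, rfl⟩
  have hpn : ¬ p ∣ n := fun h ↦ hcop (h.trans hndvd)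
  -- an exponent `s` with `x₀ ^ (p^(E-1) * s) = x₀`
  obtain ⟨s, hs⟩ : ∃ s : ℕ, x₀ ^ (p ^ (E - 1) * s) = x₀ := by
    by_cases hn1 : n = 1
    · refine ⟨1, ?_⟩
      have hx1 : x₀ = 1 := orderOf_eq_one_iff.mp hn1
      rw [hx1, one_pow]
    · have hn0 : n ≠ 0 := fun h0 ↦ hpn (by rw [h0]; exact dvd_zero p)
      have hn2 : 1 < n := by omega
      have hcopr : Nat.Coprime (p ^ (E - 1)) n :=
        Nat.Coprime.pow_left _ ((Nat.Prime.coprime_iff_not_dvd hp).mpr hpn)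
      obtain ⟨m, -, hm⟩ := Nat.exists_mul_mod_eq_one_of_coprime hcopr hn2
      refine ⟨m, ?_⟩
      rw [← pow_mod_orderOf, ← hn, hm, pow_one]
  -- (K): `τ ∈ res Γ_K` with `ρ̄(τ) = x₀ ^ s`
  obtain ⟨τ, hτH, hτ⟩ := hKE (σ₀ ^ s)
  have hρτ : ρ τ = x₀ ^ s := by rw [hτ, map_pow]
  -- `k = τ ^ (p^(E-1))` has `ρ̄(k) = x₀`
  set k := τ ^ (p ^ (E - 1)) with hk
  have hkH : k ∈ H := H.pow_mem hτH _
  have hρk : ρ k = x₀ := by rw [hk, map_pow, hρτ, ← pow_mul, mul_comm, hs]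
  -- `τ` fixes `ζ_p = ζ ^ p^(E-1)` (`det ρ̄(τ) = 1`), hence `k` fixes `ζ`
  have hdetτ : modPCyclotomicCharacterZMod ℚ p τ = 1 := by
    rw [← hdet τ, show galoisRepTorsion W p τ = x₀ ^ s from hρτ, map_pow, map_pow, hx₀, hdet1, one_pow]
  have hEsplit : p ^ E = p ^ (E - 1) * p := by
    rw [← pow_succ, Nat.sub_add_cancel hE]
  set ζp := ζ ^ (p ^ (E - 1)) with hζp
  have hζp_prim : IsPrimitiveRoot ζp p := by
    rw [hζp]
    exact hζ.pow (pow_pos hp.pos E) hEsplit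
  have hζp_pow : ζp ^ p = 1 := hζp_prim.pow_eq_one
  have hτζp : τ • ζp = ζp := by
    rw [modPCyclotomicCharacterZMod_spec ℚ p τ ζp hζp_pow, hdetτ, Units.val_one,
      ZMod.val_one'' hp.one_lt.ne', pow_one]
  set a : ℕ := ((modNCyclotomicCharacter ℚ (p ^ E) τ : (ZMod (p ^ E))ˣ) : ZMod (p ^ E)).val with ha
  have hτζ : τ • ζ = ζ ^ a := modNCyclotomicCharacter_spec ℚ (p ^ E) τ ζ hζ.pow_eq_one
  -- `a ≡ 1 (mod p)`
  have hζ0 : ζ ≠ 0 := hζ.ne_zero (NeZero.ne _)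
  have ha1 : p ∣ a - 1 ∨ a = 0 := by
    by_cases ha0 : a = 0
    · exact Or.inr ha0
    · left
      have h1 : ζp ^ a = ζp := by
        have : τ • ζp = (τ • ζ) ^ (p ^ (E - 1)) := by rw [hζp, smul_pow']
        rw [this, hτζ, ← pow_mul, mul_comm, pow_mul] at hτζp
        exact hτζp
      have h2 : ζp ^ (a - 1) = 1 := by
        have hζp0 : ζp ≠ 0 := pow_ne_zero _ hζ0
        have : ζp ^ (a - 1) * ζp = ζp := by
          rw [← pow_succ, Nat.sub_add_cancel (Nat.pos_of_ne_zero ha0), h1]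
        exact mul_left_eq_self₀.mp this |>.resolve_right hζp0
      exact (hζp_prim.pow_eq_one_iff_dvd _).mp h2
  -- `k • ζ = ζ`
  have hpowsmul : ∀ m : ℕ, (τ ^ m) • ζ = ζ ^ (a ^ m) := by
    intro m
    induction m with
    | zero => rw [pow_zero, one_smul, pow_zero, pow_one]
    | succ m ih => rw [pow_succ, mul_smul, hτζ, smul_pow', ih, ← pow_mul, ← pow_succ]
  have hkζ : k • ζ = ζ := by
    rw [hk, hpowsmul]
    rcases ha1 with hdvd | ha0
    · -- `p^E ∣ a^(p^(E-1)) - 1`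
      have ha_pos : 1 ≤ a := by
        by_contra h
        have : a = 0 := by omega
        rw [this] at hdvd
        -- `p ∣ 0 - 1 = 0` is fine in ℕ (0 - 1 = 0); but then `a = 0` gives `ζ^0 = 1`; handle via the unit being nonzero
        have hval : ((modNCyclotomicCharacter ℚ (p ^ E) τ : (ZMod (p ^ E))ˣ) : ZMod (p ^ E)) = 0 := by
          rw [← ZMod.natCast_zmod_val ((modNCyclotomicCharacter ℚ (p ^ E) τ : (ZMod (p ^ E))ˣ) : ZMod (p ^ E)), ← ha, this,
            Nat.cast_zero]
        haveI : Fact (1 < p ^ E) := ⟨Nat.one_lt_pow (by omega) hp.one_lt⟩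
        exact (Units.ne_zero _) hval
      have hint : ((p : ℤ) ^ (E - 1 + 1)) ∣ (a : ℤ) ^ (p ^ (E - 1)) - 1 ^ (p ^ (E - 1)) := by
        apply dvd_sub_pow_of_dvd_sub
        have : ((a - 1 : ℕ) : ℤ) = (a : ℤ) - 1 := by push_cast [Nat.cast_sub ha_pos]; ring
        rw [← this]
        exact_mod_cast hdvd
      rw [one_pow, Nat.sub_add_cancel hE] at hint
      have hnat : p ^ E ∣ a ^ (p ^ (E - 1)) - 1 := by
        have h1 : 1 ≤ a ^ (p ^ (E - 1)) := Nat.one_le_pow _ _ ha_pos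
        have : ((a ^ (p ^ (E - 1)) - 1 : ℕ) : ℤ) = (a : ℤ) ^ (p ^ (E - 1)) - 1 := by
          push_cast [Nat.cast_sub h1]; ring
        exact_mod_cast (this ▸ hint : ((p : ℤ) ^ E) ∣ ((a ^ (p ^ (E - 1)) - 1 : ℕ) : ℤ))
      obtain ⟨q, hq⟩ := hnat
      have h1 : 1 ≤ a ^ (p ^ (E - 1)) := Nat.one_le_pow _ _ ha_pos
      have : a ^ (p ^ (E - 1)) = 1 + p ^ E * q := by omega
      rw [this, pow_add, pow_one, pow_mul, hζ.pow_eq_one, one_pow, mul_one]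
    · -- `a = 0` is impossible (a unit of `ZMod (p^E)` has non-zero value); but `ζ ^ 0^m`: for `m ≥ 1` this is `ζ^0 = 1 ≠ ζ` — we derive a contradiction instead
      exfalso
      have hval : ((modNCyclotomicCharacter ℚ (p ^ E) τ : (ZMod (p ^ E))ˣ) : ZMod (p ^ E)) = 0 := by
        rw [← ZMod.natCast_zmod_val ((modNCyclotomicCharacter ℚ (p ^ E) τ : (ZMod (p ^ E))ˣ) : ZMod (p ^ E)), ← ha, ha0,
          Nat.cast_zero]
      haveI : Fact (1 < p ^ E) := ⟨Nat.one_lt_pow (by omega) hp.one_lt⟩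
      exact (Units.ne_zero _) hval
  -- the witness `γ = c₀ k`
  refine ⟨c₀ * k, fun h ↦ hc₀H (by simpa using H.mul_mem h (H.inv_mem hkH)), by rw [mul_smul, hkζ, hc₀ζ], ?_⟩
  rw [← htr, show galoisRepTorsion W p (c₀ * k) = ρ (c₀ * σ₀) by rw [map_mul, map_mul, hρk]]
  exact htr0

end Summit.BirchSwinnertonDyer.BirchSwinnertonDyer.Theorems.AuxPrimeSupplyCorner

end
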